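import Literature.Computability.AlgebraicComplexity.DDS21UABPWeaklySkew
import Literature.Computability.AlgebraicComplexity.ZariskiClosureEpsBorderSPS
import Literature.Computability.AlgebraicComplexity.DDS21Thm32Holds
import Literature.Computability.AlgebraicComplexity.OrbitClosure
import Literature.Computability.AlgebraicComplexity.ValiantConjectureEquivProofs
import HarnessLib

/-!
# Dutta–Dwivedi–Saxena 2021, Thm. 1.1 in the Zariski / `VP_ws` currency:
# the closure of constant-top-fan-in depth-three circuits lies in `VBP`

Source: P. Dutta, P. Dwivedi, N. Saxena, *Demystifying the border of depth-3 algebraic circuits*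
(FOCS 2021), Thm. 1.1 ("`\overline{Σ^{[k]}ΠΣ} ⊆ VBP` for constant `k`") = Thm. 3.2 (quantitative,
the tree's `DDS2021_thm_3_2_holds`, stated over `F(ε)`-approximations and univariate-label ABPs).
This file reads the tree's theorem in the currency of Bürgisser–Landsberg–Manivel–Weyman 2011 §9.3
(border = Zariski closure of coefficient vectors, Def. 9.3.1; `VP_ws` = p-bounded weakly-skew
complexity, §9.1) through the two proved bridges `EpsZariski.epsOfZariskiSPS`
(`ZariskiClosureEpsBorderSPS.lean`) and `UABPWs.vpwsOfUABP` (`DDS21UABPWeaklySkew.lean`).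

## What is proved

`isVPwsFamily_of_isBorderSPSFamily_const`: for every constant `k₀`, every family
`f_n ∈ ℂ[x_1..x_{v(n)}]` with `v` p-bounded whose coefficient vectors lie in the Zariski closure of
`Σ^{[k₀]}Π^{[d(n)]}Σ` with `d` p-bounded is a `VP_ws` family (`IsVPwsFamily`), hence p-computable and
in `VNP` (`isVNPFamily_of_isBorderSPSFamily_const`).  Top fan-in `0` is the zero class
(`eq_zero_of_isBorderSPSFamily_zero`).  No named facts, no `sorry`; census +0.  Honest framing: a
published 2021 theorem re-read across two formal renderings of "border"; nothing here bears on VP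
versus VNP.

References: [DuttaDwivediSaxena2022] Thm. 1.1, Thm. 3.2, Def. 2.1, Def. 2.5; [BurgisserEtAl2011]
Def. 9.3.1 and §9.1; [MulmuleySohoni2001] §4.
-/

noncomputable section

namespace Literature.Computability.AlgebraicComplexity

open MvPolynomial

namespace DDS2021

/-- Border `Σ^{[k]}Π^{[d]}Σ` families in the Zariski rendering (BLMW Def. 9.3.1 applied to the
syntactic class `MS2021.IsSPS (k n) (d n)` of Medini–Shpilka Def. 9 = DDS21's `Σ^{[k]}Π^{[d]}Σ`):
the coefficient vector of every `f_n` lies in the Zariski closure of the coefficient vectors of the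
class. [cite: BurgisserEtAl2011, Def. 9.3.1] -/
def IsBorderSPSFamily (k d : ℕ → ℕ) {v : ℕ → ℕ} (f : ∀ n, MvPolynomial (Fin (v n)) ℂ) : Prop :=
  ∀ n, coeffVec (f n) ∈
    zariskiClosure (coeffVec '' {g : MvPolynomial (Fin (v n)) ℂ | MS2021.IsSPS (k n) (d n) g})

/-- Top fan-in `0`: the class `Σ^{[0]}ΠΣ` is `{0}`, and so is its Zariski closure.
[cite: DuttaDwivediSaxena2022, Def. 2.1 (degenerate case)] -/
theorem eq_zero_of_isBorderSPSFamily_zero {v : ℕ → ℕ} {f : ∀ n, MvPolynomial (Fin (v n)) ℂ}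
    {d : ℕ → ℕ} (hf : IsBorderSPSFamily (fun _ => 0) d f) (n : ℕ) : f n = 0 := by
  classical
  ext e
  have h := (mem_zariskiClosure_iff.1 (hf n)) (MvPolynomial.X e) (by
    rintro _ ⟨g, hg, rfl⟩
    obtain ⟨a, rfl⟩ := EpsZariski.isSPS_iff.1 hg
    rw [MvPolynomial.aeval_X, coeffVec_apply]
    simp [EpsZariski.sps])
  rw [MvPolynomial.aeval_X, coeffVec_apply] at h
  rw [h, MvPolynomial.coeff_zero]

/-- **DDS21 Thm. 1.1 (positive constant top fan-in), Zariski / `VP_ws` currency**: border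
`Σ^{[k₀]}Π^{[d]}Σ` families with `1 ≤ k₀` constant, `d` and the variable sets p-bounded, are `VP_ws`
families.  From `DDS2021_thm_3_2_holds` with budget `s = k₀ + d(n) + v(n) + 2` (ABP size
`s^{c·k₀·7^{k₀}}`), bridge A `EpsZariski.epsOfZariskiSPS` and bridge B `UABPWs.vpwsOfUABP`.
[cite: DuttaDwivediSaxena2022, Thm. 1.1 and Thm. 3.2] -/
theorem isVPwsFamily_of_isBorderSPSFamily_pos (k₀ : ℕ) (hk : 1 ≤ k₀) (v : ℕ → ℕ)
    (f : ∀ n, MvPolynomial (Fin (v n)) ℂ) (hv : IsPBounded v)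
    (hf : ∃ d : ℕ → ℕ, IsPBounded d ∧ IsBorderSPSFamily (fun _ => k₀) d f) : IsVPwsFamily f := by
  obtain ⟨c, hc⟩ := DDS2021_thm_3_2_holds
  obtain ⟨c', hc'⟩ := UABPWs.vpwsOfUABP ℂ
  obtain ⟨d, hd, hf⟩ := hf
  have key : ∀ n, wsComplexity (f n) ≤
      ((k₀ + d n + v n + 2) ^ (c * k₀ * 7 ^ k₀) + v n + 2) ^ c' := fun n =>
    hc' (v n) _ (f n) (hc ℂ (v n) k₀ (d n) (k₀ + d n + v n + 2) (f n) hk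
      (by omega) (by omega) (by omega) (by omega)
      (EpsZariski.epsOfZariskiSPS (v n) k₀ (d n) (f n) hk (hf n)))
  have hs : IsPBounded fun n => k₀ + d n + v n + 2 :=
    IsPBounded.add_holds (IsPBounded.add_holds (IsPBounded.add_holds (IsPBounded.const k₀) hd) hv)
      (IsPBounded.const 2)
  have hS : IsPBounded fun n => (k₀ + d n + v n + 2) ^ (c * k₀ * 7 ^ k₀) + v n + 2 :=
    IsPBounded.add_holds (IsPBounded.add_holds (IsPBounded.pow_holds hs _) hv) (IsPBounded.const 2)
  exact (IsPBounded.pow_holds hS c').mono key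

/-- **DDS21 Thm. 1.1, Zariski / `VP_ws` currency (all constant top fan-ins)**: border
`Σ^{[k₀]}Π^{[d]}Σ` families with `k₀` constant and `d`, `v` p-bounded are `VP_ws = VBP` families.
[cite: DuttaDwivediSaxena2022, Thm. 1.1] -/
theorem isVPwsFamily_of_isBorderSPSFamily_const (k₀ : ℕ) (v : ℕ → ℕ)
    (f : ∀ n, MvPolynomial (Fin (v n)) ℂ) (hv : IsPBounded v)
    (hf : ∃ d : ℕ → ℕ, IsPBounded d ∧ IsBorderSPSFamily (fun _ => k₀) d f) : IsVPwsFamily f := by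
  rcases Nat.eq_zero_or_pos k₀ with rfl | hk
  · obtain ⟨d, -, hf⟩ := hf
    have h0 : ∀ n, f n = 0 := eq_zero_of_isBorderSPSFamily_zero hf
    refine (IsPBounded.const 0).mono fun n => ?_
    rw [h0 n]
    exact (wsComplexity_le_formulaComplexity _).trans
      (by rw [← MvPolynomial.C_0]; exact UABPWs.formulaComplexity_C_le (0 : ℂ))
  · exact isVPwsFamily_of_isBorderSPSFamily_pos k₀ hk v f hv hf

/-- Corollary: such families are p-computable and `VNP` families (`VP_ws ⊆ VP ⊆ VNP`, BLMW §9.1).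
[cite: DuttaDwivediSaxena2022, Thm. 1.1] -/
theorem isVNPFamily_of_isBorderSPSFamily_const (k₀ : ℕ) (v : ℕ → ℕ)
    (f : ∀ n, MvPolynomial (Fin (v n)) ℂ) (hv : IsPBounded v)
    (hf : ∃ d : ℕ → ℕ, IsPBounded d ∧ IsBorderSPSFamily (fun _ => k₀) d f) :
    IsPComputable f ∧ IsVNPFamily f :=
  have hws := isVPwsFamily_of_isBorderSPSFamily_const k₀ v f hv hf
  ⟨hws.isPBounded_complexity,
    IsVPFamily.isVNPFamily_holds' (hws.isVPFamily (by simpa only [Fintype.card_fin] using hv))⟩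

end DDS2021

end Literature.Computability.AlgebraicComplexity
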